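/-
COR-CM (cell pub-hodgecm2, stage 2 of the Hodge ladder) — count-neutral KERNEL COMBINATORICS «dicyclic twist, even order: reducing faces killed by the
strict-half functionals, II (the equator; the rule)» (seat prover-pub-hodgecm2-b23-g43-0, binder prover b23, gen 43; claim DICYCLIC-EVEN, HOME/INBOX.md
l.10881; blanket `Census/DicyclicTwist*`).  Theorems only, on top of `Census/DicyclicTwistEvenReducing.lean`; no `decide` beyond closed identities in
`ZMod 2`, no certificate, no named fact, no `sorry`.  `Interfaces.lean` (C1), every E term, B01, `Transposition/*`, `PortJoin/*` untouched.
HONEST FRAMING: `HC_CM` is NOT proved, here or anywhere in the tree; nothing here is a period, a count of record or a headline.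
T5: n/a-class (no hypothesis binders beyond the model's data); checker: self, 2026-08-23.
-/
import Summits.HodgeConjecture.CorCM.Census.DicyclicTwistEvenReducing

/-!
# The dicyclic twist `Dic(ℤ/2 × A)`, `|A|` even, IV: rule faces at the equator, and THE RULE

For `|A| = m` even the labels `(φ, ψ)` with a coordinate ON THE EQUATOR `2·wt = m` need reducing faces of prescribed kind to be killed by the
strict-half functionals of `Census/DicyclicTwistEvenFunctionals.lean` (numerically, no other kind is killed):

* §1 classes and halves one and two flips off an equator label;
* §2 **`(eq, eq)`**: any `0`-coordinate square flipping two bits of equal value (`exists_rule_ee`; killed by `UE`, `UX` since their weights vanish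
  when the passive coordinate is on the equator — NOT by `SE₀`, `SE₁`);
* §3 **`(eq, 0)`**: the `0`-coordinate square flipping two ZEROS of `φ` (`exists_rule_eq_zero`), and `(eq, 1)` = its conjugate, flipping two ONES
  (`exists_rule_eq_one`);
* §4 **`(eq, cls 1)`**: the mixed square at a bit `i` of `φ` with `φ i = [ψ low]` and the reducing place of `ψ` (`exists_rule_eq_cls_one`);
* §5 the mirrors `(·, eq)` and the strict `1`-coordinate squares by `x` (`Census/DicyclicTwistEvenReducing.lean` §2);
* §6 **THE RULE** (`exists_rule`, `|A| ≥ 3`, any parity): through every label of potential `≥ 2` there is a face of the model (a `0`- or `1`-coordinate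
  square at two distinct places, or a mixed square) in the Hodge lattice, equal to `1` there and otherwise supported in smaller potential, killed by all
  `UE s`, `UX s`, and killed by `SE₀`, `SE₁` unless the potential is `|A|` (the double equator).
All [folklore].

## References
* [Pohlmann1968] H. Pohlmann, Algebraic cycles on abelian varieties of complex multiplication type, Ann. of Math. 88 (1968), Thm 1.
-/

namespace Summit.HodgeConjecture.CorCM.Census.DicyclicTwist

open Finset
open Summit.HodgeConjecture.CorCM.Census.OddSliceFacesModel
open Summit.HodgeConjecture.CorCM.Census.OddSliceFacesSquares
open Summit.HodgeConjecture.CorCM.Census.OddSliceFacesDescent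
open Summit.HodgeConjecture.CorCM.Census.EvenSliceFacesDescent

variable (A : Type) [AddCommGroup A] [Fintype A] [DecidableEq A]

/-! ## §1 Flips off the equator -/

omit [AddCommGroup A] [DecidableEq A] in
/-- On the equator the class is the weight. [folklore] -/
theorem clsTy_of_eq {φ : Ty A} (h : 2 * wt A φ = Fintype.card A) : clsTy A φ = wt A φ := by
  unfold clsTy; omega

omit [AddCommGroup A] [DecidableEq A] in
/-- The conjugate of an equator label is on the equator. [folklore] -/
theorem eq_add_one {φ : Ty A} (h : 2 * wt A φ = Fintype.card A) : 2 * wt A (φ + 1) = Fintype.card A := by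
  rw [wt_add_one]; have := wt_le A φ; omega

omit [AddCommGroup A] in
/-- **Flipping a ONE of an equator label**: class `wt − 1`, strictly low. [folklore] -/
theorem flip_one_of_eq {φ : Ty A} (h : 2 * wt A φ = Fintype.card A) {i : A} (hi : φ i = 1) :
    clsTy A (φ + δ A i) + 1 = wt A φ ∧ loI A (φ + δ A i) = 1 ∧ upI A (φ + δ A i) = 0 := by
  have w := wt_add_delta_of_apply_eq_one A hi
  have hw := wt_pos_of_one A hi
  refine ⟨by unfold clsTy; omega, ?_⟩
  exact loI_upI_of_lt A (by omega)

omit [AddCommGroup A] in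
/-- **Flipping a ZERO of an equator label**: class `wt − 1`, strictly high. [folklore] -/
theorem flip_zero_of_eq {φ : Ty A} (h : 2 * wt A φ = Fintype.card A) {i : A} (hi : φ i = 0) :
    clsTy A (φ + δ A i) + 1 = wt A φ ∧ loI A (φ + δ A i) = 0 ∧ upI A (φ + δ A i) = 1 := by
  have w := wt_add_delta_of_zero A hi
  have hwle := wt_le A (φ + δ A i)
  refine ⟨by unfold clsTy; omega, ?_⟩
  exact loI_upI_of_gt A (by omega)

omit [AddCommGroup A] in
/-- **Flipping two ONES of an equator label**: class `wt − 2`, strictly low. [folklore] -/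
theorem flip_two_ones_of_eq {φ : Ty A} (h : 2 * wt A φ = Fintype.card A) {i j : A} (hi : φ i = 1) (hj : φ j = 1) (hij : i ≠ j) :
    clsTy A (φ + δ A i + δ A j) + 2 = wt A φ ∧ loI A (φ + δ A i + δ A j) = 1 ∧ upI A (φ + δ A i + δ A j) = 0 := by
  have w := wt_corner_flip A hi hj hij
  have h2 : 2 ≤ wt A φ := by
    have h1 := wt_pos_of_one A hi
    have := wt_add_delta_of_apply_eq_one A hi
    have hj' : (φ + δ A i) j = 1 := by rw [add_delta_apply_ne A (Ne.symm hij)]; exact hj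
    have := wt_pos_of_one A hj'
    omega
  refine ⟨by unfold clsTy; omega, ?_⟩
  exact loI_upI_of_lt A (by omega)

omit [AddCommGroup A] in
/-- **Flipping two ZEROS of an equator label**: class `wt − 2`, strictly high. [folklore] -/
theorem flip_two_zeros_of_eq {φ : Ty A} (h : 2 * wt A φ = Fintype.card A) {i j : A} (hi : φ i = 0) (hj : φ j = 0) (hij : i ≠ j) :
    clsTy A (φ + δ A i + δ A j) + 2 = wt A φ ∧ loI A (φ + δ A i + δ A j) = 0 ∧ upI A (φ + δ A i + δ A j) = 1 := by
  have hj' : (φ + δ A i) j = 0 := by rw [add_delta_apply_ne A (Ne.symm hij)]; exact hj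
  have w1 := wt_add_delta_of_zero A hi
  have w2 := wt_add_delta_of_zero A hj'
  have hwle := wt_le A (φ + δ A i + δ A j)
  refine ⟨by unfold clsTy; omega, ?_⟩
  exact loI_upI_of_gt A (by omega)

omit [AddCommGroup A] [DecidableEq A] in
/-- Two zeros of an equator label of weight `≥ 2`. [folklore] -/
theorem exists_two_zeros_of_eq {φ : Ty A} (h : 2 * wt A φ = Fintype.card A) (h2 : 2 ≤ wt A φ) :
    ∃ i j : A, i ≠ j ∧ φ i = 0 ∧ φ j = 0 := by
  have h2' : 2 ≤ wt A (φ + 1) := by rw [wt_add_one]; omega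
  obtain ⟨i, j, hij, hi, hj⟩ := exists_two_defects A h2'
  have key : ∀ u : ZMod 2, u + 1 = 1 → u = 0 := by decide
  exact ⟨i, j, hij, key _ (by simpa using hi), key _ (by simpa using hj)⟩

/-! ## §2 The double equator -/

/-- **RULE FACE at `(eq, eq)`**: a `0`-coordinate square flipping two ones of `φ`; covers the label, killed by `UE`, `UX` (weight `≥ 2`). [folklore] -/
theorem exists_rule_ee {φ ψ : Ty A} (hφ : 2 * wt A φ = Fintype.card A) (hψ : 2 * wt A ψ = Fintype.card A) (h2 : 2 ≤ wt A φ) :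
    ∃ v : Ty₂ A → ℤ, (∃ i j : A, i ≠ j ∧ v = faceVec₀ A φ i j ψ) ∧ v ∈ hodge₂ A ∧
      (v (φ, ψ) = 1 ∧ ∀ χ, χ ≠ (φ, ψ) → v χ ≠ 0 → pot A χ < pot A (φ, ψ)) ∧ ((∀ s, UE A s v = 0) ∧ (∀ s, UX A s v = 0)) := by
  obtain ⟨i, j, hij, hi, hj⟩ := exists_two_defects A h2
  have hc := clsTy_of_eq A hφ
  have c1 := (flip_one_of_eq A hφ hi).1
  have c2 := (flip_one_of_eq A hφ hj).1
  have c3 := (flip_two_ones_of_eq A hφ hi hj hij).1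
  have hψ' := eq_add_one A hψ
  refine ⟨faceVec₀ A φ i j ψ, ⟨i, j, hij, rfl⟩, faceVec₀_mem A φ hij ψ, cover_faceVec₀ A ψ (by omega) (by omega) (by omega),
    fun s => ?_, fun s => ?_⟩
  · rw [UE_apply, dot_faceVec₀, wE_eq_zero_of_snd_eq A s hψ, wE_eq_zero_of_snd_eq A s hψ', wE_eq_zero_of_snd_eq A s hψ',
      wE_eq_zero_of_snd_eq A s hψ]; ring
  · rw [UX_apply, dot_faceVec₀, wX_eq_zero_of_snd_eq A s hψ, wX_eq_zero_of_snd_eq A s hψ', wX_eq_zero_of_snd_eq A s hψ',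
      wX_eq_zero_of_snd_eq A s hψ]; ring

/-! ## §3 Equator over a constant -/

/-- **RULE FACE at `(eq, 0)`**: the `0`-coordinate square flipping two ZEROS of `φ`; killed by all four functionals (weight `≥ 2`). [folklore] -/
theorem exists_rule_eq_zero {φ : Ty A} (hφ : 2 * wt A φ = Fintype.card A) (h2 : 2 ≤ wt A φ) :
    ∃ v : Ty₂ A → ℤ, (∃ i j : A, i ≠ j ∧ v = faceVec₀ A φ i j 0) ∧ v ∈ hodge₂ A ∧
      (v (φ, 0) = 1 ∧ ∀ χ, χ ≠ (φ, 0) → v χ ≠ 0 → pot A χ < pot A (φ, 0)) ∧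
      ((∀ s, UE A s v = 0) ∧ (∀ s, UX A s v = 0) ∧ SE₀ A v = 0 ∧ SE₁ A v = 0) := by
  obtain ⟨i, j, hij, hi, hj⟩ := exists_two_zeros_of_eq A hφ h2
  have h1 : 1 ≤ Fintype.card A := by omega
  have hc := clsTy_of_eq A hφ
  obtain ⟨c1, l1, u1⟩ := flip_zero_of_eq A hφ hi
  obtain ⟨c2, l2, u2⟩ := flip_zero_of_eq A hφ hj
  obtain ⟨c3, l3, u3⟩ := flip_two_zeros_of_eq A hφ hi hj hij
  have he := loI_upI_of_eq A hφ
  have h0 := loI_zero A h1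
  have e01 : (0 : Ty A) + 1 = 1 := zero_add 1
  refine ⟨faceVec₀ A φ i j 0, ⟨i, j, hij, rfl⟩, faceVec₀_mem A φ hij 0, cover_faceVec₀ A 0 (by omega) (by omega) (by omega),
    fun s => ?_, fun s => ?_, ?_, ?_⟩
  · rw [UE_apply, dot_faceVec₀, e01, wE_snd_zero A h1, wE_snd_one A h1, wE_snd_one A h1, wE_snd_zero A h1]; ring
  · rw [UX_apply, dot_faceVec₀, bar_corner_eq, bar_corner_eq, wX_conj, wX_conj, wX_eq_zero_of_fst_eq A s hφ]
    unfold wX; simp only [l1, u1, l2, u2, l3, u3, h0.1, h0.2]; ring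
  · rw [SE₀_apply, dot_faceVec₀, bar_corner_eq, bar_corner_eq, wS₀_conj, wS₀_conj]
    unfold wS₀ sgI eqI; simp only [l1, u1, l2, u2, l3, u3, h0.1, h0.2, he.1, he.2]; ring
  · rw [SE₁_apply, dot_faceVec₀, bar_corner_eq, bar_corner_eq, wS₁_conj, wS₁_conj]
    unfold wS₁ sgI eqI; simp only [l1, u1, l2, u2, l3, u3, h0.1, h0.2, he.1, he.2]; ring

/-- **RULE FACE at `(eq, 1)`**: the conjugate of the previous one — the `0`-coordinate square flipping two ONES of `φ`. [folklore] -/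
theorem exists_rule_eq_one {φ : Ty A} (hφ : 2 * wt A φ = Fintype.card A) (h2 : 2 ≤ wt A φ) :
    ∃ v : Ty₂ A → ℤ, (∃ i j : A, i ≠ j ∧ v = faceVec₀ A φ i j 1) ∧ v ∈ hodge₂ A ∧
      (v (φ, 1) = 1 ∧ ∀ χ, χ ≠ (φ, 1) → v χ ≠ 0 → pot A χ < pot A (φ, 1)) ∧
      ((∀ s, UE A s v = 0) ∧ (∀ s, UX A s v = 0) ∧ SE₀ A v = 0 ∧ SE₁ A v = 0) := by
  have hφ' := eq_add_one A hφ
  have h2' : 2 ≤ wt A (φ + 1) := by rw [wt_add_one]; omega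
  obtain ⟨v, ⟨i, j, hij, rfl⟩, hmem, hcov, hk⟩ := exists_rule_eq_zero A hφ' h2'
  refine ⟨translH A (1, 0) (faceVec₀ A (φ + 1) i j 0), ⟨i, j, hij, ?_⟩, translH_mem A hmem _, ?_, killedE_translH A hk _⟩
  · rw [translH_faceVec₀]; simp only [tw_one_zero, add_one_add_one, sub_zero, zero_add]
  · have h := cover_translH A hcov (1, 0)
    rwa [twH_one_zero, add_one_add_one, zero_add] at h

/-! ## §4 Equator over a label of class one -/

omit [AddCommGroup A] [DecidableEq A] in
/-- A bit of an equator label with prescribed value (weight `≥ 2`). [folklore] -/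
theorem exists_apply_eq_of_eq {φ : Ty A} (hφ : 2 * wt A φ = Fintype.card A) (h2 : 2 ≤ wt A φ) (e : ZMod 2) : ∃ i : A, φ i = e := by
  have h01 : ∀ u : ZMod 2, u = 0 ∨ u = 1 := by decide
  rcases h01 e with rfl | rfl
  · obtain ⟨i, -, -, hi, -⟩ := exists_two_zeros_of_eq A hφ h2; exact ⟨i, hi⟩
  · obtain ⟨i, -, -, hi, -⟩ := exists_two_defects A h2; exact ⟨i, hi⟩

/-- **RULE FACE at `(eq, cls 1)`**: the mixed square at a bit `i` of `φ` with `φ i = [ψ low]` and the reducing place of `ψ`; killed by all four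
functionals (`|A| ≥ 3`, weight of `φ` `≥ 2`). [folklore] -/
theorem exists_rule_eq_cls_one (h3 : 3 ≤ Fintype.card A) {φ ψ : Ty A} (hφ : 2 * wt A φ = Fintype.card A) (h2 : 2 ≤ wt A φ)
    (hψ : clsTy A ψ = 1) :
    ∃ v : Ty₂ A → ℤ, (∃ i j : A, v = faceVecM A φ i ψ j) ∧ v ∈ hodge₂ A ∧
      (v (φ, ψ) = 1 ∧ ∀ χ, χ ≠ (φ, ψ) → v χ ≠ 0 → pot A χ < pot A (φ, ψ)) ∧
      ((∀ s, UE A s v = 0) ∧ (∀ s, UX A s v = 0) ∧ SE₀ A v = 0 ∧ SE₁ A v = 0) := by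
  obtain ⟨j, hj, hlj, huj, hψne, -⟩ := exists_one_reducing_strict A h3 hψ
  have hc := clsTy_of_eq A hφ
  have he := loI_upI_of_eq A hφ
  -- the bit of `φ` to flip: a one if `ψ` is low, a zero if `ψ` is high; either way the flip lands in the strict half of `ψ`
  obtain ⟨i, hi, hli, hui⟩ : ∃ i : A, clsTy A (φ + δ A i) + 1 = wt A φ ∧ loI A (φ + δ A i) = loI A ψ ∧ upI A (φ + δ A i) = upI A ψ := by
    by_cases hlow : 2 * wt A ψ < Fintype.card A
    · obtain ⟨i, hi⟩ := exists_apply_eq_of_eq A hφ h2 1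
      obtain ⟨c, l, u⟩ := flip_one_of_eq A hφ hi
      have hl := loI_upI_of_lt A hlow
      exact ⟨i, c, by rw [l, hl.1], by rw [u, hl.2]⟩
    · obtain ⟨i, hi⟩ := exists_apply_eq_of_eq A hφ h2 0
      obtain ⟨c, l, u⟩ := flip_zero_of_eq A hφ hi
      have hl := loI_upI_of_gt A (φ := ψ) (by omega)
      exact ⟨i, c, by rw [l, hl.1], by rw [u, hl.2]⟩
  -- the strict half of `ψ`
  have hl : (loI A ψ = 1 ∧ upI A ψ = 0) ∨ (loI A ψ = 0 ∧ upI A ψ = 1) := by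
    by_cases h : 2 * wt A ψ < Fintype.card A
    · exact Or.inl (loI_upI_of_lt A h)
    · exact Or.inr (loI_upI_of_gt A (by omega))
  have e2 : ((φ + 1, ψ + 1 + δ A j) : Ty₂ A) = (φ + 1, ψ + δ A j + 1) := by rw [add_right_comm ψ]
  refine ⟨faceVecM A φ i ψ j, ⟨i, j, rfl⟩, faceVecM_mem A φ i ψ j, cover_faceVecM A (by omega) (by rw [hj, hψ]; omega),
    fun s => ?_, fun s => ?_, ?_, ?_⟩
  · rw [UE_apply, dot_faceVecM, bar_corner_eq, e2, wE_conj, wE_eq_zero_of_fst_eq A s hφ, wE_eq_zero_of_fst_eq A s (eq_add_one A hφ)]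
    rcases hl with ⟨l, u⟩ | ⟨l, u⟩
    · unfold wE; simp only [hlj, huj, hli, hui, l, u]; ring
    · unfold wE; simp only [hlj, huj, hli, hui, l, u]; ring
  · rw [UX_apply, dot_faceVecM, bar_corner_eq, e2, wX_conj, wX_eq_zero_of_fst_eq A s hφ, wX_eq_zero_of_fst_eq A s (eq_add_one A hφ)]
    unfold wX; simp only [hlj, huj]; ring
  · rw [SE₀_apply, dot_faceVecM, bar_corner_eq, e2, wS₀_conj, wS₀_conj]
    unfold wS₀ sgI eqI; simp only [hlj, huj, hli, hui, he.1, he.2]; ring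
  · rw [SE₁_apply, dot_faceVecM, bar_corner_eq, e2, wS₁_conj, wS₁_conj]
    unfold wS₁ sgI eqI; simp only [hlj, huj, hli, hui, he.1, he.2]; ring

/-! ## §5 The mirrors -/

/-- **RULE FACE, strict `1`-coordinate square** (mirror of `exists_rule_strict₀`). [folklore] -/
theorem exists_rule_strict₁ (φ : Ty A) {ψ : Ty A} (h2 : 2 ≤ clsTy A ψ) (hne : 2 * wt A ψ ≠ Fintype.card A) :
    ∃ v : Ty₂ A → ℤ, (∃ i j : A, i ≠ j ∧ v = faceVec₁ A φ ψ i j) ∧ v ∈ hodge₂ A ∧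
      (v (φ, ψ) = 1 ∧ ∀ χ, χ ≠ (φ, ψ) → v χ ≠ 0 → pot A χ < pot A (φ, ψ)) ∧
      ((∀ s, UE A s v = 0) ∧ (∀ s, UX A s v = 0) ∧ SE₀ A v = 0 ∧ SE₁ A v = 0) := by
  have hwle := wt_le A ψ
  have h2' : 2 ≤ clsTy A (rev A ψ + 1) := by rw [clsTy_add_one, clsTy_rev]; exact h2
  have hne' : 2 * wt A (rev A ψ + 1) ≠ Fintype.card A := by rw [wt_add_one, wt_rev]; omega
  obtain ⟨v, ⟨i, j, hij, rfl⟩, hmem, hcov, hk⟩ := exists_rule_strict₀ A (rev A φ) h2' hne'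
  refine ⟨translX A (faceVec₀ A (rev A ψ + 1) i j (rev A φ)), ⟨-i, -j, neg_injective.ne hij, ?_⟩, translX_mem A hmem,
    cover_mirror A (by rw [twXinv_mk]; exact hcov), killedE_translX A hk⟩
  rw [translX_faceVec₀, rev_add_one, rev_rev, rev_rev, add_one_add_one]

/-- **RULE FACE at `(0, eq)`** (mirror of `(eq, 1)`): the `1`-coordinate square flipping two ONES of `ψ`. [folklore] -/
theorem exists_rule_zero_eq {ψ : Ty A} (hψ : 2 * wt A ψ = Fintype.card A) (h2 : 2 ≤ wt A ψ) :
    ∃ v : Ty₂ A → ℤ, (∃ i j : A, i ≠ j ∧ v = faceVec₁ A 0 ψ i j) ∧ v ∈ hodge₂ A ∧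
      (v (0, ψ) = 1 ∧ ∀ χ, χ ≠ (0, ψ) → v χ ≠ 0 → pot A χ < pot A (0, ψ)) ∧
      ((∀ s, UE A s v = 0) ∧ (∀ s, UX A s v = 0) ∧ SE₀ A v = 0 ∧ SE₁ A v = 0) := by
  have hψ' : 2 * wt A (rev A ψ + 1) = Fintype.card A := by rw [wt_add_one, wt_rev]; have := wt_le A ψ; omega
  have h2' : 2 ≤ wt A (rev A ψ + 1) := by rw [wt_add_one, wt_rev]; have := wt_le A ψ; omega
  obtain ⟨v, ⟨i, j, hij, rfl⟩, hmem, hcov, hk⟩ := exists_rule_eq_zero A hψ' h2'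
  refine ⟨translX A (faceVec₀ A (rev A ψ + 1) i j 0), ⟨-i, -j, neg_injective.ne hij, ?_⟩, translX_mem A hmem,
    cover_mirror A (by rw [twXinv_mk, rev_zero']; exact hcov), killedE_translX A hk⟩
  rw [translX_faceVec₀, rev_add_one, rev_rev, add_one_add_one, rev_zero']

/-- **RULE FACE at `(1, eq)`** (mirror of `(eq, 0)`): the `1`-coordinate square flipping two ZEROS of `ψ`. [folklore] -/
theorem exists_rule_one_eq {ψ : Ty A} (hψ : 2 * wt A ψ = Fintype.card A) (h2 : 2 ≤ wt A ψ) :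
    ∃ v : Ty₂ A → ℤ, (∃ i j : A, i ≠ j ∧ v = faceVec₁ A 1 ψ i j) ∧ v ∈ hodge₂ A ∧
      (v (1, ψ) = 1 ∧ ∀ χ, χ ≠ (1, ψ) → v χ ≠ 0 → pot A χ < pot A (1, ψ)) ∧
      ((∀ s, UE A s v = 0) ∧ (∀ s, UX A s v = 0) ∧ SE₀ A v = 0 ∧ SE₁ A v = 0) := by
  have hψ' : 2 * wt A (rev A ψ + 1) = Fintype.card A := by rw [wt_add_one, wt_rev]; have := wt_le A ψ; omega
  have h2' : 2 ≤ wt A (rev A ψ + 1) := by rw [wt_add_one, wt_rev]; have := wt_le A ψ; omega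
  obtain ⟨v, ⟨i, j, hij, rfl⟩, hmem, hcov, hk⟩ := exists_rule_eq_one A hψ' h2'
  have hr1 : rev A (1 : Ty A) = 1 := by
    rw [← zero_add (1 : Ty A), rev_add_one, rev_zero']
  refine ⟨translX A (faceVec₀ A (rev A ψ + 1) i j 1), ⟨-i, -j, neg_injective.ne hij, ?_⟩, translX_mem A hmem,
    cover_mirror A (by rw [twXinv_mk, hr1]; exact hcov), killedE_translX A hk⟩
  rw [translX_faceVec₀, rev_add_one, rev_rev, add_one_add_one, hr1]

/-- **RULE FACE at `(cls 1, eq)`** (mirror of `(eq, cls 1)`): a mixed square. [folklore] -/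
theorem exists_rule_cls_one_eq (h3 : 3 ≤ Fintype.card A) {φ ψ : Ty A} (hφ : clsTy A φ = 1) (hψ : 2 * wt A ψ = Fintype.card A) :
    ∃ v : Ty₂ A → ℤ, (∃ i j : A, v = faceVecM A φ i ψ j) ∧ v ∈ hodge₂ A ∧
      (v (φ, ψ) = 1 ∧ ∀ χ, χ ≠ (φ, ψ) → v χ ≠ 0 → pot A χ < pot A (φ, ψ)) ∧
      ((∀ s, UE A s v = 0) ∧ (∀ s, UX A s v = 0) ∧ SE₀ A v = 0 ∧ SE₁ A v = 0) := by
  have hψ' : 2 * wt A (rev A ψ + 1) = Fintype.card A := by rw [wt_add_one, wt_rev]; have := wt_le A ψ; omega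
  have h2' : 2 ≤ wt A (rev A ψ + 1) := by rw [wt_add_one, wt_rev]; have := wt_le A ψ; omega
  have hφ' : clsTy A (rev A φ) = 1 := by rw [clsTy_rev]; exact hφ
  obtain ⟨v, ⟨i, j, rfl⟩, hmem, hcov, hk⟩ := exists_rule_eq_cls_one A h3 hψ' h2' hφ'
  refine ⟨translX A (faceVecM A (rev A ψ + 1) i (rev A φ) j), ⟨-j, -i, ?_⟩, translX_mem A hmem,
    cover_mirror A (by rw [twXinv_mk]; exact hcov), killedE_translX A hk⟩
  rw [translX_faceVecM, rev_rev, rev_add_one, rev_rev, add_one_add_one]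

/-! ## §6 The rule -/

/-- **THE RULE of the even lane** (`|A| ≥ 3`, any parity): through every label of potential `≥ 2` there is a face of the model — a `0`- or
`1`-coordinate square at two distinct places, or a mixed square — lying in the Hodge lattice, equal to `1` at the label and otherwise supported in
smaller potential, killed by every `UE s`, `UX s`, and killed by `SE₀`, `SE₁` unless the label is on the double equator (potential `|A|`). [folklore] -/
theorem exists_rule (h3 : 3 ≤ Fintype.card A) {Ψ : Ty₂ A} (hΨ : 2 ≤ pot A Ψ) :
    ∃ v : Ty₂ A → ℤ,
      ((∃ (φ : Ty A) (i j : A) (ψ : Ty A), i ≠ j ∧ v = faceVec₀ A φ i j ψ) ∨ (∃ (ψ φ : Ty A) (i j : A), i ≠ j ∧ v = faceVec₁ A ψ φ i j) ∨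
        (∃ (φ : Ty A) (i : A) (ψ : Ty A) (j : A), v = faceVecM A φ i ψ j)) ∧
      v ∈ hodge₂ A ∧ (v Ψ = 1 ∧ ∀ χ, χ ≠ Ψ → v χ ≠ 0 → pot A χ < pot A Ψ) ∧
      ((∀ s, UE A s v = 0) ∧ (∀ s, UX A s v = 0)) ∧ (pot A Ψ < Fintype.card A → SE₀ A v = 0 ∧ SE₁ A v = 0) := by
  obtain ⟨φ, ψ⟩ := Ψ
  have hp : pot A (φ, ψ) = clsTy A φ + clsTy A ψ := rfl
  have hcφ := clsTy_le A φ
  have hcψ := clsTy_le A ψ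
  have hwφ := wt_le A φ
  have hwψ := wt_le A ψ
  -- (1) strict square in coordinate 0
  by_cases h0 : 2 ≤ clsTy A φ ∧ 2 * wt A φ ≠ Fintype.card A
  · obtain ⟨v, ⟨i, j, hij, rfl⟩, hmem, hcov, hk⟩ := exists_rule_strict₀ A ψ h0.1 h0.2
    exact ⟨_, Or.inl ⟨φ, i, j, ψ, hij, rfl⟩, hmem, hcov, ⟨hk.1, hk.2.1⟩, fun _ => ⟨hk.2.2.1, hk.2.2.2⟩⟩
  -- (2) strict square in coordinate 1
  by_cases h1 : 2 ≤ clsTy A ψ ∧ 2 * wt A ψ ≠ Fintype.card A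
  · obtain ⟨v, ⟨i, j, hij, rfl⟩, hmem, hcov, hk⟩ := exists_rule_strict₁ A φ h1.1 h1.2
    exact ⟨_, Or.inr (Or.inl ⟨φ, ψ, i, j, hij, rfl⟩), hmem, hcov, ⟨hk.1, hk.2.1⟩, fun _ => ⟨hk.2.2.1, hk.2.2.2⟩⟩
  -- (3) each coordinate is on the equator or of class ≤ 1
  have hφ1 : 2 * wt A φ = Fintype.card A ∨ clsTy A φ ≤ 1 := by
    by_cases he : 2 * wt A φ = Fintype.card A
    · exact Or.inl he
    · right; by_contra hc; exact h0 ⟨by omega, he⟩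
  have hψ1 : 2 * wt A ψ = Fintype.card A ∨ clsTy A ψ ≤ 1 := by
    by_cases he : 2 * wt A ψ = Fintype.card A
    · exact Or.inl he
    · right; by_contra hc; exact h1 ⟨by omega, he⟩
  rcases hφ1 with heφ | hφ1
  · have h2φ : 2 ≤ wt A φ := by omega
    rcases hψ1 with heψ | hψ1
    · -- (eq, eq)
      obtain ⟨v, ⟨i, j, hij, rfl⟩, hmem, hcov, hk⟩ := exists_rule_ee A heφ heψ h2φ
      have hcφ' := clsTy_of_eq A heφ
      have hcψ' := clsTy_of_eq A heψ
      refine ⟨_, Or.inl ⟨φ, i, j, ψ, hij, rfl⟩, hmem, hcov, hk, fun hlt => ?_⟩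
      exfalso; rw [hp] at hlt; omega
    · rcases Nat.lt_or_ge (clsTy A ψ) 1 with hψ0 | hψ0
      · -- (eq, const)
        rcases eq_zero_or_one_of_clsTy_eq_zero A (b := ψ) (by omega) with rfl | rfl
        · obtain ⟨v, ⟨i, j, hij, rfl⟩, hmem, hcov, hk⟩ := exists_rule_eq_zero A heφ h2φ
          exact ⟨_, Or.inl ⟨φ, i, j, 0, hij, rfl⟩, hmem, hcov, ⟨hk.1, hk.2.1⟩, fun _ => ⟨hk.2.2.1, hk.2.2.2⟩⟩
        · obtain ⟨v, ⟨i, j, hij, rfl⟩, hmem, hcov, hk⟩ := exists_rule_eq_one A heφ h2φ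
          exact ⟨_, Or.inl ⟨φ, i, j, 1, hij, rfl⟩, hmem, hcov, ⟨hk.1, hk.2.1⟩, fun _ => ⟨hk.2.2.1, hk.2.2.2⟩⟩
      · -- (eq, cls 1)
        obtain ⟨v, ⟨i, j, rfl⟩, hmem, hcov, hk⟩ := exists_rule_eq_cls_one A h3 (ψ := ψ) heφ h2φ (by omega)
        exact ⟨_, Or.inr (Or.inr ⟨φ, i, ψ, j, rfl⟩), hmem, hcov, ⟨hk.1, hk.2.1⟩, fun _ => ⟨hk.2.2.1, hk.2.2.2⟩⟩
  · rcases hψ1 with heψ | hψ1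
    · have h2ψ : 2 ≤ wt A ψ := by omega
      rcases Nat.lt_or_ge (clsTy A φ) 1 with hφ0 | hφ0
      · -- (const, eq)
        rcases eq_zero_or_one_of_clsTy_eq_zero A (b := φ) (by omega) with rfl | rfl
        · obtain ⟨v, ⟨i, j, hij, rfl⟩, hmem, hcov, hk⟩ := exists_rule_zero_eq A heψ h2ψ
          exact ⟨_, Or.inr (Or.inl ⟨0, ψ, i, j, hij, rfl⟩), hmem, hcov, ⟨hk.1, hk.2.1⟩, fun _ => ⟨hk.2.2.1, hk.2.2.2⟩⟩
        · obtain ⟨v, ⟨i, j, hij, rfl⟩, hmem, hcov, hk⟩ := exists_rule_one_eq A heψ h2ψ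
          exact ⟨_, Or.inr (Or.inl ⟨1, ψ, i, j, hij, rfl⟩), hmem, hcov, ⟨hk.1, hk.2.1⟩, fun _ => ⟨hk.2.2.1, hk.2.2.2⟩⟩
      · -- (cls 1, eq)
        obtain ⟨v, ⟨i, j, rfl⟩, hmem, hcov, hk⟩ := exists_rule_cls_one_eq A h3 (φ := φ) (by omega) heψ
        exact ⟨_, Or.inr (Or.inr ⟨φ, i, ψ, j, rfl⟩), hmem, hcov, ⟨hk.1, hk.2.1⟩, fun _ => ⟨hk.2.2.1, hk.2.2.2⟩⟩
    · -- both strict of class ≤ 1: potential ≥ 2 forces classes `1, 1`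
      have h11 : clsTy A φ = 1 ∧ clsTy A ψ = 1 := by rw [hp] at hΨ; omega
      obtain ⟨v, ⟨i, j, rfl⟩, hmem, hcov, hk⟩ := exists_rule_mixed₁₁ A h3 h11.1 h11.2
      exact ⟨_, Or.inr (Or.inr ⟨φ, i, ψ, j, rfl⟩), hmem, hcov, ⟨hk.1, hk.2.1⟩, fun _ => ⟨hk.2.2.1, hk.2.2.2⟩⟩

end Summit.HodgeConjecture.CorCM.Census.DicyclicTwist
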